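import Summits.AtomisticToContinuum.FouriersLaw.Theorems.PhononMeanFreePathCoherentDephasingStrictAbsorption
import Summits.AtomisticToContinuum.FouriersLaw.Theorems.PhononMeanFreePathIncoherentChannelReflection
import Summits.AtomisticToContinuum.FouriersLaw.Theorems.PhononMeanFreePathIncoherentChannelForecastBudget

/-!
# `IncoherentChannel`, line `two-horizons-forecast-loss` — the echo is the near autoresponse, and the
# `N`-uniform STRICT forecast budget (registered stubs `echo_eq_momResp_zero`, `strictForecastBudget`)

Helper file of line `two-horizons-forecast-loss` of crux `PhononMeanFreePath.IncoherentChannel`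
(stmt-AtomisticToContinuum-11811, lead c7, wave 1, worker W-A). Nothing here closes an item; no definitions.

Setting: `P = pinnedChain ω₂ lam β γ`, the `(N+1)`-site chain `0..N` with BOTH Langevin baths at the same
temperature `T`, `μ₀ = P.gibbsMeasure (N+1) T`, `K_t = P.transitionKernel (N+1) T T t⁺` (the constructed kernels),
`fcast … N t = K_t p_N` (mean forecast of the far momentum), `pairCorr … N t = r_N(t) = ⟨p_0, K_t p_N⟩_{μ₀}`,
the ECHO `a_N(t) = ⟨p_N, K_t p_N⟩_{μ₀}`, and the kick responses `momResp … N x t = m_x(t) = ⟨p_0, K_t p_x⟩_{μ₀}` of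
the sibling crux `CoherentDephasing` (`Theorems/PhononMeanFreePathDefs`).

* `echo_eq_momResp_zero` — `a_N(t) = m_0(t)` for every real `T`, every `N`, every real `t` (`ω₂ > 0`,
  `lam, β, γ ≥ 0`): the site reflection `R = siteReflection (N+1)` preserves `μ₀`
  (`CoherentDephasing.StrictAbsorption.reflect_integral_gibbsMeasure`), `p_0 ∘ R = p_N`, and
  `(K_t p_0)(R z) = (K_t p_N)(z)` (`reflection_leftForecast_siteReflection`); every step transports a Bochner
  integrand along a measurable involution, so no integrability is needed (junk values agree).
* `strictForecastBudget` — **the `N`-uniform STRICT forecast budget**: for `ω₂, lam, β, γ, T > 0` there is `c > 0`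
  with `∫₀^∞ (r_N² + a_N²) dt ≤ T²/(2γ) - c` for every `N ≥ 2`. This is the sibling's `N`-uniform strict absorption
  `γ(∫₀^∞ m_0² + ∫₀^∞ m_N²) ≤ T²/2 - c'` (`CoherentDephasing.StrictAbsorption.strictAbsorption`) read through
  `m_N = r_N` (`rfl`) and `m_0 = a_N` (the echo lemma), the time integral of the sum being split with the fixed-`N`
  integrability of `r_N²` (`IncoherentBounded.rN_sq_integrableOn`) and of `a_N²` (`aN_sq_integrableOn`); `c = c'/γ`.
-/

noncomputable section

namespace Summit.AtomisticToContinuum.FouriersLaw.Theorems.PhononMeanFreePath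

open MeasureTheory Set Filter Topology
open scoped NNReal
open Literature.MathematicalPhysics.KineticTheory.HeatConduction
open Summit.AtomisticToContinuum.FouriersLaw.Theorems.CoherentDephasing.StrictAbsorption
  (reflect_integral_gibbsMeasure strictAbsorption)

/-- **The echo is the near autoresponse of the kick (registered stub `echo_eq_momResp_zero`).** For the pinned
chain with both baths at the same temperature `T` (any real `T`, `ω₂ > 0`, `lam, β, γ ≥ 0`), every `N` and every
real `t`: `a_N(t) = ∫ p_N · (K_t p_N) dμ₀ = ∫ p_0 · (K_t p_0) dμ₀ = m_0(t)`. Proof: `μ₀` is invariant under the site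
reflection `R` (`reflect_integral_gibbsMeasure`), `(R z).2 0 = z.2 (last N)` (`siteReflection_snd`, `Fin.rev_zero`)
and `(K_t p_0)(R z) = (K_t p_N)(z) = fcast … z` (`reflection_leftForecast_siteReflection`); Bochner integrals
with matching junk values, no integrability enters. [folklore] -/
theorem echo_eq_momResp_zero : ∀ ω₂ lam β γ : ℝ, 0 < ω₂ → 0 ≤ lam → 0 ≤ β → 0 ≤ γ → ∀ (T : ℝ) (N : ℕ) (t : ℝ), ∫ z, z.2 (Fin.last N) * fcast ω₂ lam β γ T N t z ∂((pinnedChain ω₂ lam β γ).gibbsMeasure (N + 1) T) = momResp ω₂ lam β γ T N 0 t := by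
  intro ω₂ lam β γ hω hl hβ hγ T N t
  unfold momResp kickResp
  rw [← reflect_integral_gibbsMeasure (ω₂ := ω₂) (lam := lam) (β := β) (γ := γ) (N + 1) T
    (fun z => z.2 0 * ∫ y, y.2 0 ∂((pinnedChain ω₂ lam β γ).transitionKernel (N + 1) T T t.toNNReal z))]
  refine integral_congr_ae (Eventually.of_forall fun z => ?_)
  simp only [siteReflection_snd, Fin.rev_zero, reflection_leftForecast_siteReflection hω hl hβ hγ]

/-- **The `N`-uniform STRICT forecast budget (registered stub `strictForecastBudget`).** For the pinned anharmonic
chain (`ω₂, lam, β, γ > 0`) with both baths at `T > 0` there is `c > 0`, independent of the length, such that for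
every `N ≥ 2`

  `∫_{t>0} (r_N(t)² + a_N(t)²) dt ≤ T²/(2γ) - c`,

`r_N = pairCorr … N` the route's coherent channel and `a_N(t) = ∫ p_N (K_t p_N) dμ₀` the echo: the unconditional
budget `T²/(2γ)` (`forecastBudget`) is NOT saturated, uniformly in `N`. Proof: the sibling crux's strict absorption
`γ(∫₀^∞ m_0² + ∫₀^∞ m_N²) ≤ T²/2 - c'` (`strictAbsorption`) with `m_N = r_N` (`rfl`) and `m_0 = a_N`
(`echo_eq_momResp_zero`); the integral of the sum splits by the fixed-`N` integrability of `r_N²`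
(`IncoherentBounded.rN_sq_integrableOn`) and `a_N²` (`aN_sq_integrableOn`); `c = c'/γ`. [folklore] -/
theorem strictForecastBudget : ∀ ω₂ lam β γ : ℝ, 0 < ω₂ → 0 < lam → 0 < β → 0 < γ → ∀ T : ℝ, 0 < T → ∃ c : ℝ, 0 < c ∧ ∀ N : ℕ, 2 ≤ N → ∫ t in Ioi (0 : ℝ), ((pairCorr ω₂ lam β γ T N t) ^ 2 + (∫ z, z.2 (Fin.last N) * fcast ω₂ lam β γ T N t z ∂((pinnedChain ω₂ lam β γ).gibbsMeasure (N + 1) T)) ^ 2) ≤ T ^ 2 / (2 * γ) - c := by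
  intro ω₂ lam β γ hω hl hβ hγ T hT
  obtain ⟨c, hc, hbound⟩ := strictAbsorption ω₂ lam β γ hω hl hβ hγ T hT
  refine ⟨c / γ, div_pos hc hγ, fun N hN => ?_⟩
  -- fixed-`N` integrability of `r_N²` and of the echo `a_N²` on `(0, ∞)` (definitional unfoldings of `pairCorr`, `fcast`)
  have hr : IntegrableOn (fun t : ℝ => (pairCorr ω₂ lam β γ T N t) ^ 2) (Ioi 0) :=
    IncoherentBounded.rN_sq_integrableOn hω hl.le hβ hγ hT N
  have ha : IntegrableOn (fun t : ℝ => (∫ z, z.2 (Fin.last N) * fcast ω₂ lam β γ T N t z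
      ∂((pinnedChain ω₂ lam β γ).gibbsMeasure (N + 1) T)) ^ 2) (Ioi 0) :=
    aN_sq_integrableOn hω hl.le hβ hγ hT N
  rw [integral_add hr ha]
  -- the echo is `m_0`, the pair correlation is `m_N`
  have he : (∫ t in Ioi (0 : ℝ), (∫ z, z.2 (Fin.last N) * fcast ω₂ lam β γ T N t z
      ∂((pinnedChain ω₂ lam β γ).gibbsMeasure (N + 1) T)) ^ 2) =
      ∫ t in Ioi (0 : ℝ), momResp ω₂ lam β γ T N 0 t ^ 2 := by
    refine integral_congr_ae (Eventually.of_forall fun t => ?_)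
    simp only [echo_eq_momResp_zero ω₂ lam β γ hω hl.le hβ.le hγ.le T N t]
  have hp : (∫ t in Ioi (0 : ℝ), (pairCorr ω₂ lam β γ T N t) ^ 2) =
      ∫ t in Ioi (0 : ℝ), momResp ω₂ lam β γ T N (Fin.last N) t ^ 2 := rfl
  rw [he, hp]
  have h := hbound N hN
  rw [show T ^ 2 / (2 * γ) - c / γ = (T ^ 2 / 2 - c) / γ by rw [sub_div, div_div], le_div_iff₀ hγ]
  calc ((∫ t in Ioi (0 : ℝ), momResp ω₂ lam β γ T N (Fin.last N) t ^ 2) +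
        ∫ t in Ioi (0 : ℝ), momResp ω₂ lam β γ T N 0 t ^ 2) * γ
      = γ * ((∫ t in Ioi (0 : ℝ), momResp ω₂ lam β γ T N 0 t ^ 2) +
          ∫ t in Ioi (0 : ℝ), momResp ω₂ lam β γ T N (Fin.last N) t ^ 2) := by ring
    _ ≤ T ^ 2 / 2 - c := h

end Summit.AtomisticToContinuum.FouriersLaw.Theorems.PhononMeanFreePath

end
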